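import Mathlib.Analysis.SpecialFunctions.Pow.Deriv
import Mathlib.Analysis.Calculus.Gradient.Basic
import Mathlib.Analysis.InnerProductSpace.PiL2
import Mathlib.Topology.Separation.Basic
import Literature.Analysis.FluidPDE.VectorCalculus
import HarnessLib

/-!
# Homogeneous stationary solutions of the incompressible Euler system (Shvydkoy 2018)

R. Shvydkoy, *Homogeneous solutions to the 3D Euler system*, Trans. Amer. Math. Soc. 370 (2018)
2517–2535 = arXiv:1510.03378 [`Shvydkoy2018`], studies stationary solutions of the
incompressible Euler system

  `V · ∇V + ∇P = 0`, `div V = 0`                                             (Shvydkoy (1))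

on `ℝ³ ∖ {0}` which are **homogeneous**: `V(x) = (v + f n)(x/|x|) / |x|^α`,
`P(x) = p(x/|x|) / |x|^{2α}` (Shvydkoy (2)), with `v` tangent and `f n` normal on the sphere
`S²`. "We are only concerned with `C¹`-solutions (at least) for which `v, f, p ∈ C¹(S²)` and the
system (1) can be understood classically in `ℝ³ ∖ {0}`" (p. 2518 = arXiv p. 2); the Appendix
derives from (1)–(2) the reduced system (6) on `S²`, whose `C¹`-solutions are exactly these
triples `(v, f, p)`.

## Contents

* `Literature.Analysis.FluidPDE.IsHomogeneousSteadyEuler α V P` — the class (1)–(2): `V`, `P` of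
  class `C¹` on `E ∖ {0}`, `V(c x) = c^{-α} V(x)` and `P(c x) = c^{-2α} P(x)` for `c > 0`,
  `x ≠ 0`, and (1) pointwise on `E ∖ {0}` (`E` a finite-dimensional real inner product space;
  the paper has `E = ℝ³`, the companion Luo–Shvydkoy 2015 has `E = ℝ²`). Proved API: the trivial
  pair (`.zero`), differentiability off the origin, **Euler's relations**
  `DV(x) x = -α V(x)`, `DP(x) x = -2α P(x)` (`fderiv_velocity_apply_self`,
  `fderiv_pressure_apply_self`), the `α = 1` constructor from the `c⁻¹`, `(c²)⁻¹` form
  (`.of_alpha_one`), and `pressure_eq_zero_of_velocity_eq_zero` (a solution with `V ≡ 0` has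
  `P ≡ 0` when `α ≠ 0`).
* `Literature.Analysis.FluidPDE.shvydkoy_homogeneousSteadyEuler_alpha_one` — NAMED FACT,
  **Shvydkoy 2018, Proposition 2.1**: "There are no `C¹`-solutions to the system (6) for
  `α = 1`", i.e. every `C¹` stationary Euler pair on `ℝ³ ∖ {0}` which is homogeneous of degree
  `-1` (velocity) / `-2` (pressure) — the Navier–Stokes (Landau) scaling — has `V ≡ 0` (and then
  `P ≡ 0`, proved corollary `shvydkoy_homogeneousSteadyEuler_alpha_one.pressure_eq_zero`). The
  printed proof (p. 2521 = arXiv p. 5): with the spherical Bernoulli function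
  `H = |v|² + f² + 2p`, at `α = 1` the reduced system gives `f + div v = 0`, `v∇f = H`,
  `v∇H = 2fH`; testing the last with `f` and integrating by parts on `S²` twice yields
  `-∫ H² dσ = ⅓ ∫ f⁴ dσ`, so `H = f = 0`, then `ω v^⊥ = 0` forces `dv = 0`, `δv = 0`, and a
  harmonic `1`-form on `S²` vanishes. (Obtained independently by Luo–Xin / [LX], footnote 1 and
  the remark after the proof.) Not proved here: it needs calculus of tangent fields on `S²`
  (covariant divergence, Hodge theory `H¹_dR(S²) = 0`), absent from Mathlib at this pin.

## Context (Shvydkoy 2018, §5.1, p. 2530 = arXiv p. 12; not formalised)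

`α = 1` is the only scaling available to homogeneous stationary **Navier–Stokes** solutions, all
of which are Landau solutions (Šverák 2011). For axisymmetric swirl-free Euler fields at `α = 1`
the Stokes stream function integrates to `ψ² = A x² + B x + C`, `x = cos φ` — a family singular
on the axis unless `A = B = C = 0`; correspondingly smooth Landau solutions converge to `0` as
`ν → 0` ("the only way to restore solutions to Euler via vanishing viscosity limit is through a
sequence of singular solutions"). Existence of homogeneous solutions of other degrees: Shvydkoy
§2 (examples for `α ≤ -1` and the irrotational `α ∈ ℤ ∖ {1}`), Abe 2024 (arXiv:2305.05987).

## Design notes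

* "No `C¹`-solutions" means no **non-trivial** ones: `(V, P) = (0, 0)` solves (1)–(2) for every
  `α` (`IsHomogeneousSteadyEuler.zero`), and the printed proof shows exactly `v = f = 0`
  (i.e. `V = 0` on `ℝ³ ∖ {0}`) and `H = 0` (whence `p = 0`). The fact concludes `V x = 0` for
  `x ≠ 0`; `P x = 0` is then *proved* from Euler's relation `DP(x) x = -2 P(x)` and `∇P = 0`.
* The hypotheses of the Lean class imply the printed ones: a `C¹` field on `ℝ³ ∖ {0}` restricts
  to `C¹` components `v = V|_{S²} - ⟨V, n⟩ n`, `f = ⟨V|_{S²}, n⟩`, `p = P|_{S²}` on `S²`, and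
  degree-`(-α, -2α)` homogeneity is (2); conversely `C¹` data on `S²` extend to `C¹` homogeneous
  fields, so the two classes coincide. Regularity is exactly `C¹` (the paper's "at least"),
  the weakest printed hypothesis.
* Homogeneity is stated with real powers `c ^ (-α)` (`Real.rpow`), `c > 0`, only at `x ≠ 0`
  (nothing is asserted about the junk values `V 0`, `P 0`). Derivatives are Mathlib's `fderiv`,
  `gradient`; `(V·∇)V = convect V V` and `div V = VectorCalculus.divergence V` are the tree's
  (`VectorCalculus.lean`); on the open set `{x ≠ 0}` where `V`, `P` are `C¹` these are the
  classical derivatives.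

## Mathlib search

No homogeneous-function predicate for maps between normed spaces (only `MvPolynomial.IsHomogeneous`
and graded-ring homogeneity); no stationary Euler predicate. Used: `Real.hasDerivAt_rpow_const`,
`HasFDerivAt.comp_hasDerivAt`, `HasDerivAt.unique`, `isOpen_ne`, `gradient`,
`ContDiffOn.differentiableOn`.

## References

* R. Shvydkoy, *Homogeneous solutions to the 3D Euler system*, Trans. Amer. Math. Soc. 370
  (2018), no. 4, 2517–2535, doi:10.1090/tran/7022 = arXiv:1510.03378; Prop. 2.1, §5.1,
  Appendix. [`Shvydkoy2018`]
* X. Luo, R. Shvydkoy, *2D homogeneous solutions to the Euler equation*, Comm. PDE 40 (2015)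
  1666–1687 (the planar classification).
* V. Šverák, *On Landau's solutions of the Navier–Stokes equations*, J. Math. Sci. 179 (2011)
  208–228 = arXiv:math/0604550.
* K. Abe, *Existence of homogeneous Euler flows of degree `-α ∉ [-2, 0]`*, Arch. Ration. Mech.
  Anal. 248 (2024) = arXiv:2305.05987.
-/

noncomputable section

open Set Filter
open scoped InnerProductSpace RealInnerProductSpace Topology

namespace Literature.Analysis.FluidPDE

section General

variable {E : Type*} [NormedAddCommGroup E] [InnerProductSpace ℝ E] [FiniteDimensional ℝ E]

/-- **Homogeneous stationary solutions of the incompressible Euler system** (Shvydkoy 2018,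
(1)–(2), p. 2518: `V · ∇V + ∇P = 0`, `div V = 0` classically on `ℝ³ ∖ {0}`, with
`V(x) = (v + f n)/|x|^α`, `P(x) = p/|x|^{2α}`, `v, f, p ∈ C¹(S²)`), on a finite-dimensional real
inner product space `E` in place of `ℝ³`: the pair `(V, P)` is `C¹` on `E ∖ {0}`, homogeneous of
degrees `-α` and `-2α` under dilations `x ↦ c x`, `c > 0`, divergence free and a pointwise
solution of the stationary Euler equations off the origin. The values `V 0`, `P 0` are
irrelevant (junk). [cite: Shvydkoy2018, (1)–(2) p. 2518] -/
structure IsHomogeneousSteadyEuler (α : ℝ) (V : E → E) (P : E → ℝ) : Prop where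
  /-- The velocity is `C¹` on `E ∖ {0}` ("`v, f ∈ C¹(S²)`"). -/
  contDiffOn_velocity : ContDiffOn ℝ 1 V {x | x ≠ 0}
  /-- The pressure is `C¹` on `E ∖ {0}` ("`p ∈ C¹(S²)`"). -/
  contDiffOn_pressure : ContDiffOn ℝ 1 P {x | x ≠ 0}
  /-- `V(c x) = c^{-α} V(x)` for `c > 0`, `x ≠ 0` (Shvydkoy (2)). -/
  velocity_smul : ∀ ⦃c : ℝ⦄, 0 < c → ∀ ⦃x : E⦄, x ≠ 0 → V (c • x) = c ^ (-α) • V x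
  /-- `P(c x) = c^{-2α} P(x)` for `c > 0`, `x ≠ 0` (Shvydkoy (2)). -/
  pressure_smul : ∀ ⦃c : ℝ⦄, 0 < c → ∀ ⦃x : E⦄, x ≠ 0 → P (c • x) = c ^ (-(2 * α)) * P x
  /-- Incompressibility `div V = 0` on `E ∖ {0}` (Shvydkoy (1)). -/
  divergence_eq_zero : ∀ ⦃x : E⦄, x ≠ 0 → VectorCalculus.divergence V x = 0
  /-- The stationary Euler equation `(V·∇)V + ∇P = 0` on `E ∖ {0}` (Shvydkoy (1)). -/
  momentum : ∀ ⦃x : E⦄, x ≠ 0 → convect V V x + gradient P x = 0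

namespace IsHomogeneousSteadyEuler

variable {α : ℝ} {V : E → E} {P : E → ℝ}

/-- The trivial pair `(V, P) = (0, 0)` is a homogeneous stationary Euler solution of every degree
(so "no solutions" in Shvydkoy's Prop. 2.1 means "no non-trivial solutions"). [folklore] -/
theorem zero (α : ℝ) : IsHomogeneousSteadyEuler α (0 : E → E) (0 : E → ℝ) where
  contDiffOn_velocity := contDiffOn_const
  contDiffOn_pressure := contDiffOn_const
  velocity_smul c _ x _ := by simp
  pressure_smul c _ x _ := by simp
  divergence_eq_zero x _ := by simp [VectorCalculus.divergence, Pi.zero_def]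
  momentum x _ := by simp [convect, Pi.zero_def]

/-- The velocity of a homogeneous stationary Euler pair is differentiable off the origin
(`{x ≠ 0}` is open). [folklore] -/
theorem differentiableAt_velocity (h : IsHomogeneousSteadyEuler α V P) {x : E} (hx : x ≠ 0) :
    DifferentiableAt ℝ V x :=
  (h.contDiffOn_velocity.differentiableOn one_ne_zero).differentiableAt (isOpen_ne.mem_nhds hx)

/-- The pressure of a homogeneous stationary Euler pair is differentiable off the origin. [folklore] -/
theorem differentiableAt_pressure (h : IsHomogeneousSteadyEuler α V P) {x : E} (hx : x ≠ 0) :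
    DifferentiableAt ℝ P x :=
  (h.contDiffOn_pressure.differentiableOn one_ne_zero).differentiableAt (isOpen_ne.mem_nhds hx)

omit [InnerProductSpace ℝ E] [FiniteDimensional ℝ E] in
/-- **Euler's relation along one ray**: if `Φ (c • x) = c ^ m • Φ x` for all `c > 0` (one fixed
`x`) and `Φ` is differentiable at `x`, then `DΦ(x) x = m Φ(x)` (differentiate at `c = 1` and use
uniqueness of derivatives). [folklore] -/
theorem _root_.Literature.Analysis.FluidPDE.fderiv_apply_self_of_smul_eq_rpow_smul
    [NormedSpace ℝ E] {F : Type*} [NormedAddCommGroup F] [NormedSpace ℝ F] {Φ : E → F} {x : E}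
    {m : ℝ} (hΦ : ∀ ⦃c : ℝ⦄, 0 < c → Φ (c • x) = c ^ m • Φ x) (hd : DifferentiableAt ℝ Φ x) :
    fderiv ℝ Φ x x = m • Φ x := by
  have hline : HasDerivAt (fun c : ℝ => c • x) x 1 := by
    simpa using (hasDerivAt_id (1 : ℝ)).smul_const x
  have hd1 : DifferentiableAt ℝ Φ ((1 : ℝ) • x) := by rwa [one_smul]
  have h1 : HasDerivAt (fun c : ℝ => Φ (c • x)) (fderiv ℝ Φ x x) 1 := by
    have := hd1.hasFDerivAt.comp_hasDerivAt (1 : ℝ) hline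
    rwa [one_smul] at this
  have h2 : HasDerivAt (fun c : ℝ => c ^ m • Φ x) ((m * (1 : ℝ) ^ (m - 1)) • Φ x) 1 :=
    (Real.hasDerivAt_rpow_const (Or.inl one_ne_zero)).smul_const (Φ x)
  have heq : (fun c : ℝ => Φ (c • x)) =ᶠ[𝓝 1] fun c => c ^ m • Φ x := by
    filter_upwards [Ioi_mem_nhds one_pos] with c hc
    exact hΦ hc
  have := h1.unique (h2.congr_of_eventuallyEq heq)
  rw [this, Real.one_rpow, mul_one]

/-- **Euler's relation for the velocity**: `DV(x) x = -α V(x)` for `x ≠ 0` (degree `-α`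
homogeneity differentiated along the ray through `x`; Shvydkoy 2018, Appendix, first formula). [folklore] -/
theorem fderiv_velocity_apply_self (h : IsHomogeneousSteadyEuler α V P) {x : E} (hx : x ≠ 0) :
    fderiv ℝ V x x = (-α) • V x :=
  fderiv_apply_self_of_smul_eq_rpow_smul (fun _ hc => h.velocity_smul hc hx)
    (h.differentiableAt_velocity hx)

/-- **Euler's relation for the pressure**: `DP(x) x = -2α P(x)` for `x ≠ 0` (Shvydkoy 2018,
Appendix, first formula, applied to `P = p/|x|^{2α}`). [folklore] -/
theorem fderiv_pressure_apply_self (h : IsHomogeneousSteadyEuler α V P) {x : E} (hx : x ≠ 0) :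
    fderiv ℝ P x x = -(2 * α) * P x := by
  have := fderiv_apply_self_of_smul_eq_rpow_smul (Φ := P) (x := x) (m := -(2 * α))
    (fun c hc => by rw [h.pressure_smul hc hx, smul_eq_mul]) (h.differentiableAt_pressure hx)
  rwa [smul_eq_mul] at this

/-- If the velocity of a homogeneous stationary Euler pair of degree `-α ≠ 0` vanishes off the
origin, so does the pressure: `∇P = -(V·∇)V = 0` there, and Euler's relation
`DP(x) x = -2α P(x)` gives `P(x) = 0` (the step "`H = |v|² + f² + 2p = 0`, hence `p = 0`" of
Shvydkoy 2018, proof of Prop. 2.1, in bulk variables). [folklore] -/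
theorem pressure_eq_zero_of_velocity_eq_zero (h : IsHomogeneousSteadyEuler α V P) (hα : α ≠ 0)
    (hV : ∀ ⦃x : E⦄, x ≠ 0 → V x = 0) ⦃x : E⦄ (hx : x ≠ 0) : P x = 0 := by
  have hgrad : gradient P x = 0 := by
    have hm := h.momentum hx
    rwa [convect_apply, hV hx, map_zero, zero_add] at hm
  have hfd : fderiv ℝ P x = 0 := by
    have hdual : (InnerProductSpace.toDual ℝ E).symm (fderiv ℝ P x) = 0 := hgrad
    simpa using hdual
  have heuler := h.fderiv_pressure_apply_self hx
  rw [hfd, zero_apply] at heuler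
  have hne : -(2 * α) ≠ 0 := neg_ne_zero.mpr (mul_ne_zero two_ne_zero hα)
  exact (mul_eq_zero.mp heuler.symm).resolve_left hne

/-- The `α = 1` (Navier–Stokes / Landau scaling) class from its elementary form:
`V(c x) = c⁻¹ V(x)`, `P(c x) = (c²)⁻¹ P(x)` (Shvydkoy 2018, (2) with `α = 1`; §5.1). [folklore] -/
theorem of_alpha_one (hV : ContDiffOn ℝ 1 V {x | x ≠ 0}) (hP : ContDiffOn ℝ 1 P {x | x ≠ 0})
    (hVs : ∀ ⦃c : ℝ⦄, 0 < c → ∀ ⦃x : E⦄, x ≠ 0 → V (c • x) = c⁻¹ • V x)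
    (hPs : ∀ ⦃c : ℝ⦄, 0 < c → ∀ ⦃x : E⦄, x ≠ 0 → P (c • x) = (c ^ 2)⁻¹ * P x)
    (hdiv : ∀ ⦃x : E⦄, x ≠ 0 → VectorCalculus.divergence V x = 0)
    (hmom : ∀ ⦃x : E⦄, x ≠ 0 → convect V V x + gradient P x = 0) :
    IsHomogeneousSteadyEuler 1 V P where
  contDiffOn_velocity := hV
  contDiffOn_pressure := hP
  velocity_smul c hc x hx := by rw [hVs hc hx, Real.rpow_neg_one]
  pressure_smul c hc x hx := by
    have h2 : (-(2 * (1 : ℝ))) = -2 := by norm_num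
    rw [hPs hc hx, h2, Real.rpow_neg hc.le, Real.rpow_two]
  divergence_eq_zero := hdiv
  momentum := hmom

/-- In the `α = 1` class, `V(c x) = c⁻¹ V(x)` for `c > 0`, `x ≠ 0`. [folklore] -/
theorem velocity_smul_of_alpha_one (h : IsHomogeneousSteadyEuler 1 V P) ⦃c : ℝ⦄ (hc : 0 < c)
    ⦃x : E⦄ (hx : x ≠ 0) : V (c • x) = c⁻¹ • V x := by
  rw [h.velocity_smul hc hx, Real.rpow_neg_one]

/-- In the `α = 1` class, `P(c x) = (c²)⁻¹ P(x)` for `c > 0`, `x ≠ 0`. [folklore] -/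
theorem pressure_smul_of_alpha_one (h : IsHomogeneousSteadyEuler 1 V P) ⦃c : ℝ⦄ (hc : 0 < c)
    ⦃x : E⦄ (hx : x ≠ 0) : P (c • x) = (c ^ 2)⁻¹ * P x := by
  have h2 : (-(2 * (1 : ℝ))) = -2 := by norm_num
  rw [h.pressure_smul hc hx, h2, Real.rpow_neg hc.le, Real.rpow_two]

/-- **Rigid rotations are homogeneous stationary Euler flows of degree `1` (`α = -1`)**: for a
skew-adjoint `A` (`⟪A x, y⟫ = -⟪x, A y⟫`) the pair `V x = A x`, `P x = ½ ‖A x‖²` satisfies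
`(V·∇)V = A² x = -∇P` and `div V = tr A = 0`. In `ℝ³` with `A = a e₃ × ·` this is Shvydkoy's
purely rotational state (32) at `α = -1`, `V = a ⟨-y, x, 0⟩`, `P = a² (x² + y²)/2` (Shvydkoy
2018, §4). Shows the class is inhabited non-trivially. [cite: Shvydkoy2018, §4 eq. (32)] -/
theorem rigidRotation (A : E →L[ℝ] E) (hA : ∀ x y : E, ⟪A x, y⟫ = -⟪x, A y⟫) :
    IsHomogeneousSteadyEuler (-1) (fun x => A x) (fun x => 2⁻¹ * ‖A x‖ ^ 2) where
  contDiffOn_velocity := A.contDiff.contDiffOn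
  contDiffOn_pressure := (contDiff_const.mul (A.contDiff.norm_sq ℝ)).contDiffOn
  velocity_smul c _ x _ := by rw [map_smul, neg_neg, Real.rpow_one]
  pressure_smul c _ x _ := by
    have h2 : (-(2 * (-1 : ℝ))) = 2 := by norm_num
    rw [map_smul, h2, Real.rpow_two, norm_smul, Real.norm_eq_abs, mul_pow, sq_abs]
    ring
  divergence_eq_zero x _ := by
    rw [divergence_eq_sum_inner_fderiv (stdOrthonormalBasis ℝ E)]
    refine Finset.sum_eq_zero fun i _ => ?_
    rw [show (fun x => A x) = (A : E → E) from rfl, A.fderiv]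
    have h1 := hA (stdOrthonormalBasis ℝ E i) (stdOrthonormalBasis ℝ E i)
    rw [real_inner_comm] at h1
    linarith
  momentum x _ := by
    have hsq : HasFDerivAt (fun y : E => 2⁻¹ * ‖A y‖ ^ 2)
        ((2⁻¹ : ℝ) • ((2 • innerSL ℝ (A x)).comp A)) x :=
      (((hasStrictFDerivAt_norm_sq (A x)).hasFDerivAt.comp x A.hasFDerivAt).const_mul 2⁻¹)
    have hP : HasFDerivAt (fun y : E => 2⁻¹ * ‖A y‖ ^ 2)
        (InnerProductSpace.toDual ℝ E (-(A (A x)))) x := by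
      refine hsq.congr_fderiv (ContinuousLinearMap.ext fun h => ?_)
      simp only [_root_.smul_apply, ContinuousLinearMap.comp_apply, innerSL_apply_apply,
        InnerProductSpace.toDual_apply_apply, inner_neg_left, smul_eq_mul]
      rw [hA (A x) h]
      ring
    have hgrad : gradient (fun y : E => 2⁻¹ * ‖A y‖ ^ 2) x = -(A (A x)) :=
      (hasGradientAt_iff_hasFDerivAt.mpr hP).gradient
    rw [convect_apply, hgrad, show (fun x => A x) = (A : E → E) from rfl, A.fderiv, add_neg_cancel]

end IsHomogeneousSteadyEuler

end General

/-! ### Shvydkoy 2018, Proposition 2.1: no `C¹` homogeneous solutions at the Landau scaling -/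

/-- **Shvydkoy 2018, Proposition 2.1** (Trans. AMS 370 (2018), p. 2521 = arXiv:1510.03378 p. 5;
obtained independently in [LX], footnote 1): "There are no `C¹`-solutions to the system (6) for
`α = 1`." In bulk variables (Shvydkoy (1)–(2) and the Appendix; module docstring): let
`V : ℝ³ → ℝ³`, `P : ℝ³ → ℝ` be `C¹` on `ℝ³ ∖ {0}`, homogeneous of degrees `-1` and `-2`
(`V(c x) = c⁻¹ V(x)`, `P(c x) = c⁻² P(x)`, `c > 0` — equivalently `V(x) = U(x/|x|)/|x|`,
`P(x) = p(x/|x|)/|x|²` with `U ∈ C¹(S²; ℝ³)`, `p ∈ C¹(S²)`), and solve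
`V · ∇V + ∇P = 0`, `div V = 0` pointwise on `ℝ³ ∖ {0}`. Then `V ≡ 0` on `ℝ³ ∖ {0}` (and
`P ≡ 0`, `shvydkoy_homogeneousSteadyEuler_alpha_one.pressure_eq_zero`): the only `C¹`
homogeneous stationary Euler flow with the Navier–Stokes (Landau) scaling is the trivial one.
Printed proof: `-∫_{S²} H² dσ = ⅓ ∫_{S²} f⁴ dσ` for the spherical Bernoulli function
`H = |v|² + f² + 2p`, then `dv = δv = 0` and `H¹_dR(S²) = 0`. [cite: Shvydkoy2018, Prop. 2.1] -/
def shvydkoy_homogeneousSteadyEuler_alpha_one : Prop :=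
  ∀ ⦃V : EuclideanSpace ℝ (Fin 3) → EuclideanSpace ℝ (Fin 3)⦄ ⦃P : EuclideanSpace ℝ (Fin 3) → ℝ⦄,
    IsHomogeneousSteadyEuler 1 V P → ∀ ⦃x : EuclideanSpace ℝ (Fin 3)⦄, x ≠ 0 → V x = 0

/-- **Shvydkoy 2018, Prop. 2.1, pressure part**: under the named fact, a `C¹` homogeneous
stationary Euler pair at `α = 1` on `ℝ³ ∖ {0}` also has vanishing pressure off the origin
(proved from the fact by Euler's relation, `pressure_eq_zero_of_velocity_eq_zero`). [cite: Shvydkoy2018, Prop. 2.1] -/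
theorem shvydkoy_homogeneousSteadyEuler_alpha_one.pressure_eq_zero
    (h : shvydkoy_homogeneousSteadyEuler_alpha_one)
    {V : EuclideanSpace ℝ (Fin 3) → EuclideanSpace ℝ (Fin 3)} {P : EuclideanSpace ℝ (Fin 3) → ℝ}
    (hVP : IsHomogeneousSteadyEuler 1 V P) ⦃x : EuclideanSpace ℝ (Fin 3)⦄ (hx : x ≠ 0) :
    P x = 0 :=
  hVP.pressure_eq_zero_of_velocity_eq_zero one_ne_zero (h hVP) hx

/-- **Shvydkoy 2018, Prop. 2.1, elementary form** (the shape used by route items: unbundled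
hypotheses with `c⁻¹`, `(c²)⁻¹`): under the named fact, `C¹` fields `V`, `P` on `ℝ³ ∖ {0}` with
`V(c x) = c⁻¹ V(x)`, `P(c x) = (c²)⁻¹ P(x)` (`c > 0`, `x ≠ 0`), `div V = 0` and
`(V·∇)V + ∇P = 0` off the origin satisfy `V x = 0` and `P x = 0` for every `x ≠ 0`. [cite: Shvydkoy2018, Prop. 2.1] -/
theorem shvydkoy_homogeneousSteadyEuler_alpha_one.eq_zero
    (h : shvydkoy_homogeneousSteadyEuler_alpha_one)
    {V : EuclideanSpace ℝ (Fin 3) → EuclideanSpace ℝ (Fin 3)} {P : EuclideanSpace ℝ (Fin 3) → ℝ}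
    (hV : ContDiffOn ℝ 1 V {x | x ≠ 0}) (hP : ContDiffOn ℝ 1 P {x | x ≠ 0})
    (hVs : ∀ ⦃c : ℝ⦄, 0 < c → ∀ ⦃x : EuclideanSpace ℝ (Fin 3)⦄, x ≠ 0 → V (c • x) = c⁻¹ • V x)
    (hPs : ∀ ⦃c : ℝ⦄, 0 < c → ∀ ⦃x : EuclideanSpace ℝ (Fin 3)⦄, x ≠ 0 →
      P (c • x) = (c ^ 2)⁻¹ * P x)
    (hdiv : ∀ ⦃x : EuclideanSpace ℝ (Fin 3)⦄, x ≠ 0 → VectorCalculus.divergence V x = 0)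
    (hmom : ∀ ⦃x : EuclideanSpace ℝ (Fin 3)⦄, x ≠ 0 → convect V V x + gradient P x = 0)
    ⦃x : EuclideanSpace ℝ (Fin 3)⦄ (hx : x ≠ 0) : V x = 0 ∧ P x = 0 :=
  have hVP := IsHomogeneousSteadyEuler.of_alpha_one hV hP hVs hPs hdiv hmom
  ⟨h hVP hx, h.pressure_eq_zero hVP hx⟩

end Literature.Analysis.FluidPDE
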